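import Mathlib
import Summits.Ventures.PercRepro2.TypedCountJoin

/-!
# The pendant-block reduction for the typed point-split count
(blind cell PercRepro2, night-3 g26, 2026-08-29; `proofs/NIGHT3-CERT.md` §35.6)

Let `u` be a cut vertex of the multigraph and split the edges as `S₁ ⊔ S₂`, the edges of `S₁` inside
a vertex set `V₁ ∋ s, v, u` and the edges of `S₂` inside `V₁ᶜ ∪ {u}` (a **pendant** part, containing
neither `s` nor `v` except possibly as `u`).  For a colouring `ω = ω₁ ⊔ ω₂` the cluster of `s` is
`C¹_s(ω₁) ∪ [u ∈ C¹_s(ω₁)]·C²_u(ω₂)` (`cluster_join_pendant`), the weight `[v ∈ C_s]` depends on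
`ω₁` only (`mem_cluster_join_pendant_iff`), and for fixed `ω₁` the inner sum over `ω₂` is a
typed-Harris form in `ω₂` whose two factors are monotone — so Harris on the uniform law of `S₂`
(`harris_onS` of `TypedCountJoin.lean`) bounds it below by the product of the means.  The means are
the **pendant-averaged functionals** `F̂(X) = E_{ω₂}[F(X ∪ [u ∈ X]·C²_u(ω₂))]` (monotone,
`monotone_hat`), and the outcome is

* **`typedCount_pendant_reduction`**: `2^{|S₂|} · T(S₁; F̂, Ĝ) ≤ T(S₁ ⊔ S₂; F, G)`;
* **`typedCount_nonneg_of_pendant`**: `T(S₁; F̂, Ĝ) ≥ 0 ⟹ T(S₁ ⊔ S₂; F, G) ≥ 0`.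

Hence a minimal edge set with `T < 0` has no pendant block: every block lies on the `s–v` block
path (`u = s` and `u = v` are allowed).  Own work; standard axioms.
-/

namespace Summit.Ventures.PercRepro2

namespace TypedDeletion

variable {V : Type*} {E : Type*}

/-! ## Clusters of a pendant join -/

section Pendant

open Classical

variable [DecidableEq E]

omit [DecidableEq E] in
/-- A configuration whose open edges lie inside `T` has its clusters inside `T`. -/
lemma cluster_subset_of_edges_in {ends : E → Sym2 V} {ω : Config E} {T : Set V} {z : V}
    (hz : z ∈ T) (hT : ∀ e, ω e = true → ∀ x ∈ ends e, x ∈ T) : cluster ends ω z ⊆ T := by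
  refine cluster_subset_of_closed hz ?_
  intro e x y he hxy _
  exact hT e he y (by rw [hxy]; exact Sym2.mem_mk_right x y)

omit [DecidableEq E] in
/-- **The cluster of a pendant join**: if the edges of `S₁` lie inside `V₁ ∋ s, u` and those of
`S₂` inside `V₁ᶜ ∪ {u}`, then for `ω₁ ≤ 1_{S₁}`, `ω₂ ≤ 1_{S₂}`,
`C_s(ω₁ ⊔ ω₂) = C_s(ω₁) ∪ [u ∈ C_s(ω₁)]·C_u(ω₂)`. -/
lemma cluster_join_pendant {ends : E → Sym2 V} {V₁ : Set V} {s u : V} (hs : s ∈ V₁) (hu : u ∈ V₁)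
    {S₁ S₂ : Finset E} (h₁ : ∀ e ∈ S₁, ∀ x ∈ ends e, x ∈ V₁)
    (h₂ : ∀ e ∈ S₂, ∀ x ∈ ends e, x ∉ V₁ ∨ x = u) {ω₁ ω₂ : Config E} (hω₁ : OnS S₁ ω₁)
    (hω₂ : OnS S₂ ω₂) :
    cluster ends (join ω₁ ω₂) s =
      cluster ends ω₁ s ∪ (if u ∈ cluster ends ω₁ s then cluster ends ω₂ u else ∅) := by
  classical
  have hC₁ : cluster ends ω₁ s ⊆ V₁ :=
    cluster_subset_of_edges_in hs fun e he x hx => h₁ e (hω₁ e he) x hx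
  have hC₂ : ∀ x ∈ cluster ends ω₂ u, x ∉ V₁ ∨ x = u := fun x hx =>
    cluster_subset_of_edges_in (T := {x | x ∉ V₁ ∨ x = u}) (Or.inr rfl)
      (fun e he x hx => h₂ e (hω₂ e he) x hx) hx
  -- adjacency steps inside one factor
  have step : ∀ (ω : Config E) (z x y : V) (e : E), ω e = true → ends e = s(x, y) →
      x ∈ cluster ends ω z → y ∈ cluster ends ω z := by
    intro ω z x y e he hxy hx
    by_cases hxy' : x = y
    · subst hxy'; exact hx
    · exact mem_cluster_of_adj hx (openGraph_adj.2 ⟨hxy', e, he, hxy⟩)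
  apply Set.Subset.antisymm
  · -- the join cluster is contained in the right-hand side: a closure argument
    refine cluster_subset_of_closed (Or.inl (mem_cluster_self _ _ _)) ?_
    intro e x y he hxy hx
    simp only [join_apply, Bool.or_eq_true] at he
    rcases he with he | he
    · -- an edge of `S₁`: `x ∈ V₁`, hence `x ∈ C_s(ω₁)`
      have hxV : x ∈ V₁ := h₁ e (hω₁ e he) x (by rw [hxy]; exact Sym2.mem_mk_left x y)
      have hx1 : x ∈ cluster ends ω₁ s := by
        rcases hx with hx | hx
        · exact hx
        · by_cases hu' : u ∈ cluster ends ω₁ s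
          · rw [if_pos hu'] at hx
            rcases hC₂ x hx with h | h
            · exact absurd hxV h
            · rw [h]; exact hu'
          · rw [if_neg hu'] at hx
            exact absurd hx (Set.notMem_empty x)
      exact Or.inl (step ω₁ s x y e he hxy hx1)
    · -- an edge of `S₂`: `x ∉ V₁` or `x = u`
      have hxV : x ∉ V₁ ∨ x = u := h₂ e (hω₂ e he) x (by rw [hxy]; exact Sym2.mem_mk_left x y)
      have hu' : u ∈ cluster ends ω₁ s ∧ x ∈ cluster ends ω₂ u := by
        rcases hx with hx | hx
        · have hxu : x = u := by
            rcases hxV with h | h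
            · exact absurd (hC₁ hx) h
            · exact h
          subst hxu
          exact ⟨hx, mem_cluster_self _ _ _⟩
        · by_cases hu' : u ∈ cluster ends ω₁ s
          · rw [if_pos hu'] at hx
            exact ⟨hu', hx⟩
          · rw [if_neg hu'] at hx
            exact absurd hx (Set.notMem_empty x)
      right
      rw [if_pos hu'.1]
      exact step ω₂ u x y e he hxy hu'.2
  · -- the right-hand side lies in the join cluster
    apply Set.union_subset
    · exact cluster_mono (le_join_left ω₁ ω₂) s
    · by_cases hu' : u ∈ cluster ends ω₁ s
      · rw [if_pos hu']
        intro x hx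
        have h1 : Conn ends (join ω₁ ω₂) s u := cluster_mono (le_join_left ω₁ ω₂) s hu'
        have h2 : Conn ends (join ω₁ ω₂) u x := conn_mono (le_join_right ω₁ ω₂) hx
        exact conn_trans h1 h2
      · rw [if_neg hu']
        exact Set.empty_subset _

omit [DecidableEq E] in
/-- In a pendant join the weight vertex `v ∈ V₁` is connected to `s` iff it is in `C_s(ω₁)`. -/
lemma mem_cluster_join_pendant_iff {ends : E → Sym2 V} {V₁ : Set V} {s u v : V} (hs : s ∈ V₁)
    (hu : u ∈ V₁) (hv : v ∈ V₁) {S₁ S₂ : Finset E} (h₁ : ∀ e ∈ S₁, ∀ x ∈ ends e, x ∈ V₁)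
    (h₂ : ∀ e ∈ S₂, ∀ x ∈ ends e, x ∉ V₁ ∨ x = u) {ω₁ ω₂ : Config E} (hω₁ : OnS S₁ ω₁)
    (hω₂ : OnS S₂ ω₂) :
    v ∈ cluster ends (join ω₁ ω₂) s ↔ v ∈ cluster ends ω₁ s := by
  classical
  rw [cluster_join_pendant hs hu h₁ h₂ hω₁ hω₂]
  constructor
  · intro h
    rcases h with h | h
    · exact h
    · by_cases hu' : u ∈ cluster ends ω₁ s
      · rw [if_pos hu'] at h
        have hC₂ : ∀ x ∈ cluster ends ω₂ u, x ∉ V₁ ∨ x = u := fun x hx =>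
          cluster_subset_of_edges_in (T := {x | x ∉ V₁ ∨ x = u}) (Or.inr rfl)
            (fun e he x hx => h₂ e (hω₂ e he) x hx) hx
        rcases hC₂ v h with h' | h'
        · exact absurd hv h'
        · rw [h']; exact hu'
      · rw [if_neg hu'] at h
        exact absurd h (Set.notMem_empty v)
  · intro h
    exact Or.inl h

end Pendant

/-! ## The pendant-averaged functionals and the reduction -/

section Main

open Classical

variable [Fintype E] [DecidableEq E] {R : Type*} [Field R] [LinearOrder R] [IsStrictOrderedRing R]

/-- The pendant-averaged functional `F̂(X) = E_{ω₂ ≤ 1_{S₂}}[F(X ∪ [u ∈ X]·C_u(ω₂))]`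
(`F(X)` itself when `u ∉ X`). -/
noncomputable def hat (ends : E → Sym2 V) (u : V) (S₂ : Finset E) (F : Set V → R) : Set V → R :=
  fun X => (1 / 2 : R) ^ S₂.card *
    ∑ ω₂ : Config E, (if OnS S₂ ω₂ then F (X ∪ (if u ∈ X then cluster ends ω₂ u else ∅)) else 0)

/-- The sets `X ∪ [u ∈ X]·C` are monotone in `X` (for a fixed `C`) and in `C`. -/
lemma union_ite_subset_union_ite {X Y C D : Set V} {u : V} (hXY : X ⊆ Y) (hCD : C ⊆ D) :
    X ∪ (if u ∈ X then C else ∅) ⊆ Y ∪ (if u ∈ Y then D else ∅) := by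
  by_cases hX : u ∈ X
  · have hY : u ∈ Y := hXY hX
    rw [if_pos hX, if_pos hY]
    exact Set.union_subset_union hXY hCD
  · rw [if_neg hX]
    simp only [Set.union_empty]
    exact hXY.trans Set.subset_union_left

/-- The pendant-averaged functional of a monotone functional is monotone. -/
lemma monotone_hat (ends : E → Sym2 V) (u : V) (S₂ : Finset E) {F : Set V → R} (hF : Monotone F) :
    Monotone (hat ends u S₂ F) := by
  intro X Y hXY
  unfold hat
  refine mul_le_mul_of_nonneg_left ?_ (by positivity)
  refine Finset.sum_le_sum fun ω₂ _ => ?_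
  by_cases h : OnS S₂ ω₂
  · rw [if_pos h, if_pos h]
    exact hF (union_ite_subset_union_ite hXY le_rfl)
  · rw [if_neg h, if_neg h]

/-- The unnormalised pendant sum is `2^{|S₂|} · F̂(X)`. -/
lemma sum_hat (ends : E → Sym2 V) (u : V) (S₂ : Finset E) (F : Set V → R) (X : Set V) :
    ∑ ω₂ : Config E, (if OnS S₂ ω₂ then F (X ∪ (if u ∈ X then cluster ends ω₂ u else ∅)) else 0) =
      (2 : R) ^ S₂.card * hat ends u S₂ F X := by
  unfold hat
  rw [← mul_assoc, ← mul_pow]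
  norm_num

/-- The unnormalised pendant sum over the complements is `2^{|S₂|} · F̂(Y)` as well. -/
lemma sum_hat_flip (ends : E → Sym2 V) (u : V) (S₂ : Finset E) (F : Set V → R) (Y : Set V) :
    ∑ ω₂ : Config E, (if OnS S₂ ω₂ then
        F (Y ∪ (if u ∈ Y then cluster ends (flipOn S₂ ω₂) u else ∅)) else 0) =
      (2 : R) ^ S₂.card * hat ends u S₂ F Y := by
  rw [← sum_hat]
  exact sum_onS_flip S₂ (fun ω₂ => F (Y ∪ (if u ∈ Y then cluster ends ω₂ u else ∅)))

omit [Fintype E] in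
/-- The first factor of the inner typed-Harris form is monotone in `ω₂`. -/
lemma monotone_pendant_factor (ends : E → Sym2 V) (u : V) (S₂ : Finset E) {F : Set V → R}
    (hF : Monotone F) (X Y : Set V) :
    Monotone (fun ω₂ : Config E =>
      F (X ∪ (if u ∈ X then cluster ends ω₂ u else ∅)) -
        F (Y ∪ (if u ∈ Y then cluster ends (flipOn S₂ ω₂) u else ∅))) := by
  intro ω₂ ω₂' h
  have h1 : F (X ∪ (if u ∈ X then cluster ends ω₂ u else ∅)) ≤
      F (X ∪ (if u ∈ X then cluster ends ω₂' u else ∅)) :=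
    hF (union_ite_subset_union_ite le_rfl (cluster_mono h u))
  have h2 : F (Y ∪ (if u ∈ Y then cluster ends (flipOn S₂ ω₂') u else ∅)) ≤
      F (Y ∪ (if u ∈ Y then cluster ends (flipOn S₂ ω₂) u else ∅)) :=
    hF (union_ite_subset_union_ite le_rfl (cluster_mono (flipOn_antitone S₂ h) u))
  simp only
  linarith

/-- The inner sum over the pendant colourings is bounded below by the pendant-averaged cluster
difference: `Σ_{ω₂ ≤ 1_{S₂}} (F(X ∪ …) − F(Y ∪ …))(G(X ∪ …) − G(Y ∪ …)) ≥ 2^{|S₂|} · dlt F̂ Ĝ X Y`. -/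
lemma inner_pendant_ge (ends : E → Sym2 V) (u : V) (S₂ : Finset E) {F G : Set V → R}
    (hF : Monotone F) (hG : Monotone G) (X Y : Set V) :
    (2 : R) ^ S₂.card * dlt (hat ends u S₂ F) (hat ends u S₂ G) X Y ≤
      ∑ ω₂ : Config E, (if OnS S₂ ω₂ then
        (F (X ∪ (if u ∈ X then cluster ends ω₂ u else ∅)) -
            F (Y ∪ (if u ∈ Y then cluster ends (flipOn S₂ ω₂) u else ∅))) *
          (G (X ∪ (if u ∈ X then cluster ends ω₂ u else ∅)) -
            G (Y ∪ (if u ∈ Y then cluster ends (flipOn S₂ ω₂) u else ∅))) else 0) := by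
  have key := harris_onS S₂ (monotone_pendant_factor ends u S₂ hF X Y)
    (monotone_pendant_factor ends u S₂ hG X Y)
  have hsplit : ∀ (φ₁ φ₂ : Config E → R),
      ∑ ω₂ : Config E, (if OnS S₂ ω₂ then φ₁ ω₂ - φ₂ ω₂ else 0) =
        ∑ ω₂ : Config E, (if OnS S₂ ω₂ then φ₁ ω₂ else 0) -
          ∑ ω₂ : Config E, (if OnS S₂ ω₂ then φ₂ ω₂ else 0) := by
    intro φ₁ φ₂
    rw [← Finset.sum_sub_distrib]
    refine Finset.sum_congr rfl fun ω₂ _ => ?_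
    split_ifs <;> simp
  rw [hsplit, hsplit, sum_hat, sum_hat_flip, sum_hat, sum_hat_flip] at key
  refine le_trans (le_of_eq ?_) key
  unfold dlt
  rw [← mul_sub, ← mul_sub]
  have h2 : ((1 / 2 : R) ^ S₂.card) * ((2 : R) ^ S₂.card) = 1 := by
    rw [← mul_pow]; norm_num
  calc (2 : R) ^ S₂.card * ((hat ends u S₂ F X - hat ends u S₂ F Y) *
        (hat ends u S₂ G X - hat ends u S₂ G Y))
      = ((1 / 2 : R) ^ S₂.card * (2 : R) ^ S₂.card) * ((2 : R) ^ S₂.card *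
          ((hat ends u S₂ F X - hat ends u S₂ F Y) *
            (hat ends u S₂ G X - hat ends u S₂ G Y))) := by rw [h2, one_mul]
    _ = _ := by ring

/-- **The pendant-block reduction**: for a cut vertex `u`, edges `S₁` inside `V₁ ∋ s, v, u` and
edges `S₂` inside `V₁ᶜ ∪ {u}`, the typed point-split count satisfies
`2^{|S₂|} · T(S₁; F̂, Ĝ) ≤ T(S₁ ⊔ S₂; F, G)` with the pendant-averaged functionals `F̂, Ĝ`. -/
theorem typedCount_pendant_reduction (ends : E → Sym2 V) {V₁ : Set V} {s u v : V} (hs : s ∈ V₁)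
    (hu : u ∈ V₁) (hv : v ∈ V₁) {S₁ S₂ : Finset E} (hd : Disjoint S₁ S₂)
    (h₁ : ∀ e ∈ S₁, ∀ x ∈ ends e, x ∈ V₁) (h₂ : ∀ e ∈ S₂, ∀ x ∈ ends e, x ∉ V₁ ∨ x = u)
    {F G : Set V → R} (hF : Monotone F) (hG : Monotone G) :
    (2 : R) ^ S₂.card * typedCount ends s v (hat ends u S₂ F) (hat ends u S₂ G) S₁ ∅ ≤
      typedCount ends s v F G (S₁ ∪ S₂) ∅ := by
  unfold typedCount
  simp only [withC_empty]
  have hsum := sum_onS_union hd (fun ω => wt ends s v ω *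
    dlt F G (cluster ends ω s) (cluster ends (flipOn (S₁ ∪ S₂) ω) s))
  rw [hsum, Finset.mul_sum]
  refine Finset.sum_le_sum fun ω₁ _ => ?_
  split_ifs with hω₁
  · have hY₁ : OnS S₁ (flipOn S₁ ω₁) := onS_flipOn S₁ ω₁
    have hw : (0 : R) ≤ wt ends s v ω₁ := by
      unfold wt; split_ifs <;> norm_num
    -- the inner terms in the pendant form
    have inner : ∀ ω₂ : Config E, (if OnS S₂ ω₂ then wt ends s v (join ω₁ ω₂) *
        dlt F G (cluster ends (join ω₁ ω₂) s)
          (cluster ends (flipOn (S₁ ∪ S₂) (join ω₁ ω₂)) s) else 0) =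
        wt ends s v ω₁ * (if OnS S₂ ω₂ then
          (F (cluster ends ω₁ s ∪
                (if u ∈ cluster ends ω₁ s then cluster ends ω₂ u else ∅)) -
              F (cluster ends (flipOn S₁ ω₁) s ∪
                (if u ∈ cluster ends (flipOn S₁ ω₁) s then cluster ends (flipOn S₂ ω₂) u
                  else ∅))) *
            (G (cluster ends ω₁ s ∪
                (if u ∈ cluster ends ω₁ s then cluster ends ω₂ u else ∅)) -
              G (cluster ends (flipOn S₁ ω₁) s ∪
                (if u ∈ cluster ends (flipOn S₁ ω₁) s then cluster ends (flipOn S₂ ω₂) u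
                  else ∅))) else 0) := by
      intro ω₂
      by_cases hω₂ : OnS S₂ ω₂
      · rw [if_pos hω₂, if_pos hω₂]
        have hwt : (wt ends s v (join ω₁ ω₂) : R) = wt ends s v ω₁ := by
          unfold wt
          rw [mem_cluster_join_pendant_iff hs hu hv h₁ h₂ hω₁ hω₂]
        rw [hwt, flipOn_union_join hd hω₁ hω₂, cluster_join_pendant hs hu h₁ h₂ hω₁ hω₂,
          cluster_join_pendant hs hu h₁ h₂ hY₁ (onS_flipOn S₂ ω₂)]
        rfl
      · rw [if_neg hω₂, if_neg hω₂, mul_zero]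
    simp_rw [inner]
    rw [← Finset.mul_sum]
    have hin := inner_pendant_ge ends u S₂ hF hG (cluster ends ω₁ s)
      (cluster ends (flipOn S₁ ω₁) s)
    calc (2 : R) ^ S₂.card * (wt ends s v ω₁ *
          dlt (hat ends u S₂ F) (hat ends u S₂ G) (cluster ends ω₁ s)
            (cluster ends (flipOn S₁ ω₁) s))
        = wt ends s v ω₁ * ((2 : R) ^ S₂.card *
          dlt (hat ends u S₂ F) (hat ends u S₂ G) (cluster ends ω₁ s)
            (cluster ends (flipOn S₁ ω₁) s)) := by ring
      _ ≤ _ := mul_le_mul_of_nonneg_left hin hw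
  · simp

/-- **Positivity transfers across a pendant block**: if the typed count of the reduced graph with
the pendant-averaged functionals is nonnegative, so is the typed count of the whole graph. -/
theorem typedCount_nonneg_of_pendant (ends : E → Sym2 V) {V₁ : Set V} {s u v : V} (hs : s ∈ V₁)
    (hu : u ∈ V₁) (hv : v ∈ V₁) {S₁ S₂ : Finset E} (hd : Disjoint S₁ S₂)
    (h₁ : ∀ e ∈ S₁, ∀ x ∈ ends e, x ∈ V₁) (h₂ : ∀ e ∈ S₂, ∀ x ∈ ends e, x ∉ V₁ ∨ x = u)
    {F G : Set V → R} (hF : Monotone F) (hG : Monotone G)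
    (hred : 0 ≤ typedCount ends s v (hat ends u S₂ F) (hat ends u S₂ G) S₁ ∅) :
    0 ≤ typedCount ends s v F G (S₁ ∪ S₂) ∅ :=
  le_trans (mul_nonneg (by positivity) hred)
    (typedCount_pendant_reduction ends hs hu hv hd h₁ h₂ hF hG)

end Main

end TypedDeletion

end Summit.Ventures.PercRepro2
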